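import Summits.Ventures.Crystal3D.Theorems.StickyWulffConstantNoReconstructionGainExactCriminalHeavy
import Summits.Ventures.Crystal3D.Theorems.StickyWulffConstantNoReconstructionGainExactCriminalCups
import HarnessLib

/-!
# The heavy ball of a criminal is BURIED (line `replication-exactness`, structure of minimal
# counterexamples to EXACT₀)

HONEST FRAMING. Part of the venture `Summits/Ventures/Crystal3D` (cell `crystal3d-full`), supports the
crux `NoReconstructionGain` (stmt-Ventures-19144, route `route-Ventures-StickyWulffConstant`), line
`replication-exactness` (lead wulff-p1 g18).  Two landed facts combined: a criminal contains an
off-lattice ball with at least TEN contacts (`exists_offLattice_ten_contacts_of_criminal`,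
`…ExactCriminalHeavy`), and a film ball has at most NINE partners in any closed half-space through its
centre (`card_halfspace_partners_le_nine`, `…ExactCriminalCups`, `B(3) = 9`).  Hence:

* `exists_partner_neg_side_of_ten` — a film ball with `≥ 10` partners (plugs + film balls) has, for
  EVERY unit vector `e`, a partner strictly on the negative side of the plane through its centre
  orthogonal to `e`: its contact shell surrounds it;
* `exists_buried_offLattice_of_criminal` — **every criminal contains a BURIED off-lattice ball**: an
  off-lattice ball with `≥ 10` contacts whose partners meet both open sides of every plane through it;
  in particular (`e = −ν`), if it lies on or above the cut level it has a FILM partner strictly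
  `ν`-above it — a criminal is never a monolayer around its heavy ball.

WHAT THIS IS NOT: the crux; rung F-C1 not moved.
-/

noncomputable section

namespace Summit.Ventures.Crystal3D.Theorems

open Summit.Ventures.Crystal3D
open Literature.MathematicalPhysics.StatisticalMechanics (fccStacking contactDeficiency orderedContacts)
open scoped InnerProductSpace
open Finset

/-- **A film ball with at least ten partners is surrounded**: for every unit `e` some partner (plug or
film ball) lies strictly on the negative side, `⟪e, x − q⟫ < 0`. -/
theorem exists_partner_neg_side_of_ten {ν : EuclideanSpace ℝ (Fin 3)} {s : ℝ}
    {Q : Finset (EuclideanSpace ℝ (Fin 3))} (hQ : IsFilmOn ν s Q) {q : EuclideanSpace ℝ (Fin 3)}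
    (h10 : 10 ≤ (plugSet ν s q).ncard + (Q.filter fun y => dist q y = 1).card)
    {e : EuclideanSpace ℝ (Fin 3)} (he : ‖e‖ = 1) :
    ∃ x, (x ∈ plugSet ν s q ∨ (x ∈ Q ∧ dist q x = 1)) ∧ ⟪e, x - q⟫_ℝ < 0 := by
  classical
  by_contra h
  push Not at h
  have hfin := plugSet_finite ν s q
  set T := hfin.toFinset ∪ Q.filter fun y => dist q y = 1 with hTdef
  have hdisj : Disjoint hfin.toFinset (Q.filter fun y => dist q y = 1) := by
    rw [Finset.disjoint_left]
    intro y hy hy'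
    rw [Set.Finite.mem_toFinset] at hy
    rw [Finset.mem_filter] at hy'
    have := hQ.2 y hy'.1 y hy.1
    rw [dist_self] at this; linarith
  have hTcard : T.card = (plugSet ν s q).ncard + (Q.filter fun y => dist q y = 1).card := by
    rw [hTdef, Finset.card_union_of_disjoint hdisj, Set.ncard_eq_toFinset_card _ hfin]
  have hT : ∀ x ∈ T, (x ∈ plugSet ν s q ∨ x ∈ Q) ∧ dist q x = 1 := by
    intro x hx
    rw [hTdef, Finset.mem_union, Set.Finite.mem_toFinset, Finset.mem_filter] at hx
    rcases hx with hx | hx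
    · exact ⟨Or.inl hx, hx.2⟩
    · exact ⟨Or.inr hx.1, hx.2⟩
  have hhalf : ∀ x ∈ T, 0 ≤ ⟪e, x - q⟫_ℝ := by
    intro x hx
    rw [hTdef, Finset.mem_union, Set.Finite.mem_toFinset, Finset.mem_filter] at hx
    rcases hx with hx | hx
    · exact h x (Or.inl hx)
    · exact h x (Or.inr hx)
  have h9 := card_halfspace_partners_le_nine hQ q he T hT hhalf
  omega

open scoped Classical in
/-- **Every criminal contains a BURIED off-lattice ball**: an off-lattice ball with at least ten
contacts whose partners meet the open negative side of every plane through its centre; if it lies on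
or above the cut level, one of its FILM partners is strictly `ν`-above it. -/
theorem exists_buried_offLattice_of_criminal {ν : EuclideanSpace ℝ (Fin 3)} (hν : ‖ν‖ = 1) {s : ℝ}
    {Q : Finset (EuclideanSpace ℝ (Fin 3))} (hQ : IsCriminal ν s Q) :
    ∃ q ∈ Q, q ∉ fccStacking 1 (Real.sqrt (2 / 3)) ∧
      10 ≤ (plugSet ν s q).ncard + (Q.filter fun y => dist q y = 1).card ∧
      (∀ e : EuclideanSpace ℝ (Fin 3), ‖e‖ = 1 →
        ∃ x, (x ∈ plugSet ν s q ∨ (x ∈ Q ∧ dist q x = 1)) ∧ ⟪e, x - q⟫_ℝ < 0) ∧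
      (s ≤ ⟪q, ν⟫_ℝ → ∃ y ∈ Q, dist q y = 1 ∧ ⟪q, ν⟫_ℝ < ⟪y, ν⟫_ℝ) := by
  obtain ⟨q, hq, hqΛ, h10, -, -⟩ := exists_offLattice_ten_contacts_of_criminal hQ
  refine ⟨q, hq, hqΛ, h10, fun e he => exists_partner_neg_side_of_ten hQ.1 h10 he, fun hs => ?_⟩
  have hne : ‖-ν‖ = 1 := by rw [norm_neg, hν]
  obtain ⟨x, hx, hlt⟩ := exists_partner_neg_side_of_ten hQ.1 h10 hne
  rw [inner_neg_left, inner_sub_right, neg_lt_zero, sub_pos, real_inner_comm q ν,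
    real_inner_comm x ν] at hlt
  rcases hx with hx | ⟨hxQ, hxd⟩
  · -- a plug lies below the cut, hence not above `q`
    have := hx.1.2
    linarith
  · exact ⟨x, hxQ, hxd, hlt⟩

end Summit.Ventures.Crystal3D.Theorems

end
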